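import Summits.Ventures.PercRepro.RankLevelSetLevelSixT22Cell11
import Summits.Ventures.PercRepro.RankLevelSetLevelSixT22Cell12
import Summits.Ventures.PercRepro.RankLevelSetLevelSixT22Free11Le17
import Summits.Ventures.PercRepro.RankLevelSetLevelSixT22Free12Le17
import Summits.Ventures.PercRepro.RankLevelSetLevelSixT22S1Cf12Le24
import Summits.Ventures.PercRepro.RankLevelSetLevelSixT22Assembly

/-!
# PercRepro — THE 22 ROW MODULO THREE BRANCH STATEMENTS (p8 g13, S3): the exact gap

The cells `(22, 11)` and `(22, 12)` reduced by the coloop device and the existing cell to the branch `s₃ ≥ 18` of their coloop-free cells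
(`c025_core_six_t22_free{11,12}_le17`: the existing cell closes the branch `s₃ ≤ 17`, ratios 0.999 / 0.999) and, at `(22, 12)`, the
`1`-times scaled coloop-free cell at rank `21` (the method's `1.017`; its branch `s₃ ≤ 24` closes, `c025_core_six_t22_scaled1_cf12_le24`, 0.995).
`c025_six_large_twenty_two_of_branches (h11 h12 h12s) : 22 ≤ p → RLS M p 6` states THE WHOLE 22 ROW (and every `p ≥ 22`) modulo exactly
three coloop-free statements; `c025_six_large_twenty_two_of_triangles` the same with `h12s` replaced by its branch `s₃ ≥ 25`. Axioms: standard.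
-/

open scoped Matroid

namespace PercRepro

namespace ThmN

variable {α : Type}

/-- **The cell `(22, 11)` modulo the branch `s₃ ≥ 18` of its coloop-free cell.** -/
theorem c025_core_six_twentytwo_11_of_many (M : Matroid α) [M.Finite]
    (hR : M.eRank = (22 : ℕ∞)) (hn : M.E.ncard = 22 + 11)
    (hfree : ∀ e ∈ M.E, ∃ A ⊆ M.E \ {e}, e ∉ M.closure A ∧ e ∉ M.closure ((M.E \ {e}) \ A))
    (h18 : ∀ N : Matroid α, ∀ [N.Finite], (∀ e ∈ N.E, ¬ N.IsColoop e) → N.eRank = (22 : ℕ∞) → N.E.ncard = 22 + 11 →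
      (∀ e ∈ N.E, ∃ A ⊆ N.E \ {e}, e ∉ N.closure A ∧ e ∉ N.closure ((N.E \ {e}) \ A)) →
      18 ≤ {C : Set α | N.IsCircuit C ∧ C.ncard = 3}.ncard → RLS N 22 6) : RLS M 22 6 := by
  refine c025_core_six_twentytwo_11_of_free M hR hn hfree ?_
  intro N _ hcf hRN hnN hfreeN
  by_cases h17 : {C : Set α | N.IsCircuit C ∧ C.ncard = 3}.ncard ≤ 17
  · exact c025_core_six_t22_free11_le17 N 22 le_rfl hcf h17 hRN hnN hfreeN
  · exact h18 N hcf hRN hnN hfreeN (by omega)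

/-- **The cell `(22, 12)` modulo the branch `s₃ ≥ 18` of its coloop-free cell and the `1`-scaled coloop-free cell at rank `21`.** -/
theorem c025_core_six_twentytwo_12_of_many (M : Matroid α) [M.Finite]
    (hR : M.eRank = (22 : ℕ∞)) (hn : M.E.ncard = 22 + 12)
    (hfree : ∀ e ∈ M.E, ∃ A ⊆ M.E \ {e}, e ∉ M.closure A ∧ e ∉ M.closure ((M.E \ {e}) \ A))
    (h18 : ∀ N : Matroid α, ∀ [N.Finite], (∀ e ∈ N.E, ¬ N.IsColoop e) → N.eRank = (22 : ℕ∞) → N.E.ncard = 22 + 12 →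
      (∀ e ∈ N.E, ∃ A ⊆ N.E \ {e}, e ∉ N.closure A ∧ e ∉ N.closure ((N.E \ {e}) \ A)) →
      18 ≤ {C : Set α | N.IsCircuit C ∧ C.ncard = 3}.ncard → RLS N 22 6)
    (h1 : ∀ N : Matroid α, ∀ [N.Finite], (∀ e ∈ N.E, ¬ N.IsColoop e) → N.eRank = (21 : ℕ∞) → N.E.ncard = 21 + 12 →
      (∀ e ∈ N.E, ∃ A ⊆ N.E \ {e}, e ∉ N.closure A ∧ e ∉ N.closure ((N.E \ {e}) \ A)) →
      phiK 22 6 / 2 ^ 1 * (Matroid.topCount N 21 6 : ℚ) ≤ (Matroid.midCount N 21 6 : ℚ)) : RLS M 22 6 := by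
  refine c025_core_six_twentytwo_12_of_free M hR hn hfree ?_ h1
  intro N _ hcf hRN hnN hfreeN
  by_cases h17 : {C : Set α | N.IsCircuit C ∧ C.ncard = 3}.ncard ≤ 17
  · exact c025_core_six_t22_free12_le17 N 22 le_rfl hcf h17 hRN hnN hfreeN
  · exact h18 N hcf hRN hnN hfreeN (by omega)

/-- **C-025 AT LEVEL `6` FOR EVERY `p ≥ 22` MODULO THREE COLOOP-FREE BRANCH STATEMENTS** — the exact gap of the 22 row. -/
theorem c025_six_large_twenty_two_of_branches
    (h11 : ∀ N : Matroid α, ∀ [N.Finite], (∀ e ∈ N.E, ¬ N.IsColoop e) → N.eRank = (22 : ℕ∞) → N.E.ncard = 22 + 11 →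
      (∀ e ∈ N.E, ∃ A ⊆ N.E \ {e}, e ∉ N.closure A ∧ e ∉ N.closure ((N.E \ {e}) \ A)) →
      18 ≤ {C : Set α | N.IsCircuit C ∧ C.ncard = 3}.ncard → RLS N 22 6)
    (h12 : ∀ N : Matroid α, ∀ [N.Finite], (∀ e ∈ N.E, ¬ N.IsColoop e) → N.eRank = (22 : ℕ∞) → N.E.ncard = 22 + 12 →
      (∀ e ∈ N.E, ∃ A ⊆ N.E \ {e}, e ∉ N.closure A ∧ e ∉ N.closure ((N.E \ {e}) \ A)) →
      18 ≤ {C : Set α | N.IsCircuit C ∧ C.ncard = 3}.ncard → RLS N 22 6)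
    (h12s : ∀ N : Matroid α, ∀ [N.Finite], (∀ e ∈ N.E, ¬ N.IsColoop e) → N.eRank = (21 : ℕ∞) → N.E.ncard = 21 + 12 →
      (∀ e ∈ N.E, ∃ A ⊆ N.E \ {e}, e ∉ N.closure A ∧ e ∉ N.closure ((N.E \ {e}) \ A)) →
      phiK 22 6 / 2 ^ 1 * (Matroid.topCount N 21 6 : ℚ) ≤ (Matroid.midCount N 21 6 : ℚ))
    (M : Matroid α) [M.Finite] (p : ℕ) (hp : 22 ≤ p) : RLS M p 6 :=
  c025_six_large_twenty_two_of
    (fun N _ hRN hnN hfreeN => c025_core_six_twentytwo_11_of_many N hRN hnN hfreeN h11)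
    (fun N _ hRN hnN hfreeN => c025_core_six_twentytwo_12_of_many N hRN hnN hfreeN h12 h12s) M p hp

/-- **The `1`-scaled coloop-free cell `(21, 12)@7` modulo its branch `s₃ ≥ 25`** (the branch `s₃ ≤ 24` on the existing cell). -/
theorem c025_core_six_t22_scaled1_cf12_of_many
    (h25 : ∀ N : Matroid α, ∀ [N.Finite], (∀ e ∈ N.E, ¬ N.IsColoop e) → N.eRank = (21 : ℕ∞) → N.E.ncard = 21 + 12 →
      (∀ e ∈ N.E, ∃ A ⊆ N.E \ {e}, e ∉ N.closure A ∧ e ∉ N.closure ((N.E \ {e}) \ A)) →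
      25 ≤ {C : Set α | N.IsCircuit C ∧ C.ncard = 3}.ncard →
      phiK 22 6 / 2 ^ 1 * (Matroid.topCount N 21 6 : ℚ) ≤ (Matroid.midCount N 21 6 : ℚ)) :
    ∀ N : Matroid α, ∀ [N.Finite], (∀ e ∈ N.E, ¬ N.IsColoop e) → N.eRank = (21 : ℕ∞) → N.E.ncard = 21 + 12 →
      (∀ e ∈ N.E, ∃ A ⊆ N.E \ {e}, e ∉ N.closure A ∧ e ∉ N.closure ((N.E \ {e}) \ A)) →
      phiK 22 6 / 2 ^ 1 * (Matroid.topCount N 21 6 : ℚ) ≤ (Matroid.midCount N 21 6 : ℚ) := by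
  intro N _ hcf hRN hnN hfreeN
  by_cases h24 : {C : Set α | N.IsCircuit C ∧ C.ncard = 3}.ncard ≤ 24
  · have := c025_core_six_t22_scaled1_cf12_le24 N 21 le_rfl hcf h24 hRN hnN hfreeN
    simpa using this
  · exact h25 N hcf hRN hnN hfreeN (by omega)

/-- **C-025 AT LEVEL `6` FOR EVERY `p ≥ 22` MODULO THREE MANY-TRIANGLE STATEMENTS** — coloop-free `e`-free cores of rank `22` with
`|E| = 33` / `34` and `≥ 18` triangles, and the `1`-scaled cell of rank `21`, `|E| = 33` with `≥ 25` triangles. -/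
theorem c025_six_large_twenty_two_of_triangles
        (h11 : ∀ N : Matroid α, ∀ [N.Finite], (∀ e ∈ N.E, ¬ N.IsColoop e) → N.eRank = (22 : ℕ∞) → N.E.ncard = 22 + 11 →
      (∀ e ∈ N.E, ∃ A ⊆ N.E \ {e}, e ∉ N.closure A ∧ e ∉ N.closure ((N.E \ {e}) \ A)) →
      18 ≤ {C : Set α | N.IsCircuit C ∧ C.ncard = 3}.ncard → RLS N 22 6)
    (h12 : ∀ N : Matroid α, ∀ [N.Finite], (∀ e ∈ N.E, ¬ N.IsColoop e) → N.eRank = (22 : ℕ∞) → N.E.ncard = 22 + 12 →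
      (∀ e ∈ N.E, ∃ A ⊆ N.E \ {e}, e ∉ N.closure A ∧ e ∉ N.closure ((N.E \ {e}) \ A)) →
      18 ≤ {C : Set α | N.IsCircuit C ∧ C.ncard = 3}.ncard → RLS N 22 6)
    (h12t : ∀ N : Matroid α, ∀ [N.Finite], (∀ e ∈ N.E, ¬ N.IsColoop e) → N.eRank = (21 : ℕ∞) → N.E.ncard = 21 + 12 →
      (∀ e ∈ N.E, ∃ A ⊆ N.E \ {e}, e ∉ N.closure A ∧ e ∉ N.closure ((N.E \ {e}) \ A)) →
      25 ≤ {C : Set α | N.IsCircuit C ∧ C.ncard = 3}.ncard →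
      phiK 22 6 / 2 ^ 1 * (Matroid.topCount N 21 6 : ℚ) ≤ (Matroid.midCount N 21 6 : ℚ))
    (M : Matroid α) [M.Finite] (p : ℕ) (hp : 22 ≤ p) : RLS M p 6 :=
  c025_six_large_twenty_two_of_branches h11 h12 (c025_core_six_t22_scaled1_cf12_of_many h12t) M p hp

end ThmN

end PercRepro
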